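import Mathlib
import Summits.RiemannHypothesis.RiemannHypothesis.Theorems.IntegerScrewExitAssembly
import Summits.RiemannHypothesis.RiemannHypothesis.Theorems.IntegerScrewExitGreenLower
import Summits.RiemannHypothesis.RiemannHypothesis.Theorems.IntegerScrewExitTail
import HarnessLib

/-!
# Route `IntegerScrew` — the exit density of the exit-death chain: two-sided bounds on `b·ν_exit(b)` and the
# χ² bound that closes THEOREM A (CONTINUUM-LIMIT §25.4 (b))

With `Γ = exitGamma R Q`, `ν_exit = exitInflow R Q` (unnormalised), `c = exitMassRatio R Q` and
`exitChiSq R Q = Σ_{b≤Q} b(ν_exit(b) − c/b)² = Σ_{b≤Q}(1/b)(b·ν_exit(b) − c)²` (`IntegerScrewExitAssembly`), the window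
functional satisfies `(Σ_W g/x − cΣ_B g/b)² ≤ 2[A²log²R(1/(2log²Q) − 1/(2log²R)) + exitChiSq·⌊log₂R⌋·C]·D(g)`
(`window_functional_sq_le`).  This file bounds the one remaining quantity.  For `b ≤ Q`,

  `b·ν_exit(b) = Σ_{Q/b < n ≤ R/b} (Λ(n)/n)·Γ(bn)/log(bn)`,  `B log R/log(bn) ≤ Γ(bn) ≤ A log R/log(bn)`,

so `b·ν_exit(b)` is sandwiched between `B log R·Σ''` and `A log R·Σ''`, `Σ'' = Σ_{Q/b<n≤R/b}(Λ(n)/n)/log²(bn)`, and the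
two-sided Abel step (`IntegerScrewChebyshevAbel`, `IntegerScrewExitGreenLower`) applied to the TRUNCATED weight
`f̃(t) = 1/(log b + max(t, log(Q/b+1)))²` (antitone, no singularity at `n = 1`) gives, with `c_u = 39/50` and a lower
Mertens constant `c′`:

* `exitTail_le` — `Σ'' ≤ 1/log(Q+1) − 1/log R + (c_u + c′ + 2 log 2)/log²(Q+1)`;
* `le_exitTail` — `Σ'' ≥ 1/log(2Q) − 1/(log R − log 2) − (c_u + c′ + log 2)/log²(Q+1)` (`2Q ≤ R`);
* **`mul_exitInflow_le` / `le_mul_exitInflow`** — `B log R·L₀ ≤ b·ν_exit(b) ≤ A log R·U₀` for `1 ≤ b ≤ Q`;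
* **`exitChiSq_le`** — `exitChiSq R Q ≤ H_Q·max(A log R·U₀ − c, c − B log R·L₀)²`, `H_Q = Σ_{b≤Q} 1/b`.

With `log Q = (1−δ)log R`, `A, B = 1 + O(1/((1−δ)²log R))`, `c = (log P/log Q)(1 + O(1/log P + 1/log Q))` both
deviations are `(log P/log Q)·O(1/((1−δ) log P) + 1/((1−δ)log R))` — THEOREM A's `κ_res = O(1)` (CONTINUUM-LIMIT
25.5): the flat window law for all-integer atoms is a kernel theorem modulo the numerical evaluation of these
explicit expressions.  RH-free, elementary.  Nothing in this file bears on the truth of RH.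
References: CONTINUUM-LIMIT §25.4–25.5 (rh-explicit A6-PIVOT); M. Suzuki, J. Lond. Math. Soc. (2) 108 (2023)
1448–1487 [Suzuki2023].
-/

noncomputable section

set_option linter.dupNamespace false -- D-0017: `Summit.<S>.<S>.…` is the designed namespace

namespace Summit.RiemannHypothesis.RiemannHypothesis.Theorems.IntegerScrew

open Finset Real
open ArithmeticFunction (vonMangoldt)

/-! ### `b·ν_exit(b)` sandwiched, and the χ² bound -/

/-- `b·ν_exit(b) = Σ_{Q/b < n ≤ R/b} (Λ(n)/n)·Γ(bn)/log(bn)` for `b ≥ 1`. -/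
theorem mul_exitInflow_eq {R Q b : ℕ} (hb : 1 ≤ b) :
    (b : ℝ) * exitInflow R Q b =
      ∑ n ∈ (Icc 1 (R / b)).filter (fun n => Q / b < n),
        vonMangoldt n / n * (exitGamma R Q (b * n) / Real.log ((b * n : ℕ) : ℝ)) := by
  unfold exitInflow
  rw [Finset.mul_sum, Finset.sum_filter]
  refine Finset.sum_congr rfl fun n hn => ?_
  have hn1 : 1 ≤ n := (Finset.mem_Icc.1 hn).1
  have hb0 : (b:ℝ) ≠ 0 := by positivity
  have hn0 : (n:ℝ) ≠ 0 := by positivity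
  by_cases h : Q / b < n
  · rw [if_pos h]
    push_cast
    field_simp
  · rw [if_neg h]
    have hle : n ≤ Q / b := not_lt.1 h
    have hbn : ¬(Q < b * n ∧ b * n ≤ R) := by
      intro h'
      have : b * n ≤ Q := by
        have := (Nat.le_div_iff_mul_le (by omega)).1 hle
        rwa [mul_comm] at this
      omega
    rw [exitGamma_of_not_mem hbn]
    simp

/-- **Upper bound `b·ν_exit(b) ≤ A·log R·U₀`** (`1 ≤ b ≤ Q`, `2Q ≤ R`, `A ≥ 1` with the pointwise Green bound
`Γ ≤ A log R/log x` on the window — `exitGamma_le` or `exitGamma_le_sharp'` —, lower Mertens constant `c′`). -/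
theorem mul_exitInflow_le {R Q b : ℕ} (hb : 1 ≤ b) (hbQ : b ≤ Q) (hQR : 2 * Q ≤ R) {A c' : ℝ} (hA1 : 1 ≤ A)
    (hΓU : ∀ x, Q < x → x ≤ R → exitGamma R Q x ≤ A * Real.log R / Real.log x)
    (hψ : ∀ n, 1 ≤ n → n ≤ R → Real.log n - c' ≤ ∑ k ∈ Icc 1 n, vonMangoldt k / k) :
    (b : ℝ) * exitInflow R Q b ≤ A * Real.log R *
      (1 / Real.log ((Q : ℝ) + 1) - 1 / Real.log R + (39 / 50 + c' + 2 * Real.log 2) / Real.log ((Q : ℝ) + 1) ^ 2) := by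
  rw [mul_exitInflow_eq hb]
  have hL : 0 ≤ Real.log (R:ℝ) := Real.log_natCast_nonneg R
  have hAL : 0 ≤ A * Real.log R := mul_nonneg (by linarith) hL
  have hterm : ∀ n ∈ (Icc 1 (R / b)).filter (fun n => Q / b < n),
      vonMangoldt n / n * (exitGamma R Q (b * n) / Real.log ((b * n : ℕ) : ℝ)) ≤
        A * Real.log R * (vonMangoldt n / n * (1 / Real.log ((b * n : ℕ) : ℝ) ^ 2)) := by
    intro n hn
    have hn' := Finset.mem_filter.1 hn
    have hn1 : 1 ≤ n := (Finset.mem_Icc.1 hn'.1).1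
    have hbn : Q < b * n := by
      have := Nat.lt_div_mul_add (a := Q) (b := b) (by omega)
      have : Q / b + 1 ≤ n := hn'.2
      nlinarith [Nat.div_mul_le_self Q b]
    have hbnR : b * n ≤ R := by
      have := (Nat.le_div_iff_mul_le (by omega)).1 (Finset.mem_Icc.1 hn'.1).2
      rwa [mul_comm] at this
    have hG := hΓU (b * n) hbn hbnR
    have hlog : 0 < Real.log ((b * n : ℕ) : ℝ) :=
      Real.log_pos (by exact_mod_cast (show 1 < b * n by omega))
    have hw : 0 ≤ vonMangoldt n / n := div_nonneg ArithmeticFunction.vonMangoldt_nonneg (Nat.cast_nonneg _)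
    calc vonMangoldt n / n * (exitGamma R Q (b * n) / Real.log ((b * n : ℕ) : ℝ))
        ≤ vonMangoldt n / n * ((A * Real.log R / Real.log ((b * n : ℕ) : ℝ)) / Real.log ((b * n : ℕ) : ℝ)) :=
          mul_le_mul_of_nonneg_left (div_le_div_of_nonneg_right hG hlog.le) hw
      _ = A * Real.log R * (vonMangoldt n / n * (1 / Real.log ((b * n : ℕ) : ℝ) ^ 2)) := by
          field_simp
  refine (Finset.sum_le_sum hterm).trans ?_
  rw [← Finset.mul_sum]
  exact mul_le_mul_of_nonneg_left (exitTail_le hb hbQ hQR hψ) hAL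

/-- **Lower bound `B·log R·L₀ ≤ b·ν_exit(b)`** (`1 ≤ b ≤ Q`, `2Q ≤ R`, `B ≥ 0` with the pointwise Green bound
`B log R/log x ≤ Γ` on the window — `le_exitGamma` or `le_exitGamma_sharp'` —, lower Mertens constant `c′`). -/
theorem le_mul_exitInflow {R Q b : ℕ} (hb : 1 ≤ b) (hbQ : b ≤ Q) (hQ2 : 2 ≤ Q) (hQR : 2 * Q ≤ R)
    {B c' : ℝ} (hB0 : 0 ≤ B)
    (hψ : ∀ n, 1 ≤ n → n ≤ R → Real.log n - c' ≤ ∑ k ∈ Icc 1 n, vonMangoldt k / k)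
    (hΓL : ∀ x, Q < x → x ≤ R → B * Real.log R / Real.log x ≤ exitGamma R Q x) :
    B * Real.log R *
      (1 / Real.log (2 * (Q : ℝ)) - 1 / (Real.log R - Real.log 2) - (39 / 50 + c' + Real.log 2) / Real.log ((Q : ℝ) + 1) ^ 2) ≤
      (b : ℝ) * exitInflow R Q b := by
  rw [mul_exitInflow_eq hb]
  have hL : 0 ≤ Real.log (R:ℝ) := Real.log_natCast_nonneg R
  have hBL : 0 ≤ B * Real.log R := mul_nonneg hB0 hL
  have hterm : ∀ n ∈ (Icc 1 (R / b)).filter (fun n => Q / b < n),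
      B * Real.log R * (vonMangoldt n / n * (1 / Real.log ((b * n : ℕ) : ℝ) ^ 2)) ≤
        vonMangoldt n / n * (exitGamma R Q (b * n) / Real.log ((b * n : ℕ) : ℝ)) := by
    intro n hn
    have hn' := Finset.mem_filter.1 hn
    have hn1 : 1 ≤ n := (Finset.mem_Icc.1 hn'.1).1
    have hbn : Q < b * n := by
      have := Nat.lt_div_mul_add (a := Q) (b := b) (by omega)
      have : Q / b + 1 ≤ n := hn'.2
      nlinarith [Nat.div_mul_le_self Q b]
    have hbnR : b * n ≤ R := by
      have := (Nat.le_div_iff_mul_le (by omega)).1 (Finset.mem_Icc.1 hn'.1).2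
      rwa [mul_comm] at this
    have hG := hΓL (b * n) hbn hbnR
    have hlog : 0 < Real.log ((b * n : ℕ) : ℝ) :=
      Real.log_pos (by exact_mod_cast (show 1 < b * n by omega))
    have hw : 0 ≤ vonMangoldt n / n := div_nonneg ArithmeticFunction.vonMangoldt_nonneg (Nat.cast_nonneg _)
    calc B * Real.log R * (vonMangoldt n / n * (1 / Real.log ((b * n : ℕ) : ℝ) ^ 2))
        = vonMangoldt n / n * ((B * Real.log R / Real.log ((b * n : ℕ) : ℝ)) / Real.log ((b * n : ℕ) : ℝ)) := by
          field_simp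
      _ ≤ vonMangoldt n / n * (exitGamma R Q (b * n) / Real.log ((b * n : ℕ) : ℝ)) :=
          mul_le_mul_of_nonneg_left (div_le_div_of_nonneg_right hG hlog.le) hw
  refine le_trans ?_ (Finset.sum_le_sum hterm)
  rw [← Finset.mul_sum]
  exact mul_le_mul_of_nonneg_left (le_exitTail hb hbQ hQ2 hQR hψ) hBL

/-- **The χ² bound that closes THEOREM A (CONTINUUM-LIMIT §25.4 (b)).**  Under the hypotheses of
`mul_exitInflow_le` and `le_mul_exitInflow`, with `U := A log R·U₀`, `Lo := B log R·L₀` and `c = exitMassRatio R Q`: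
`exitChiSq R Q ≤ H_Q · max(U − c, c − Lo)²`, `H_Q = Σ_{b≤Q} 1/b`. -/
theorem exitChiSq_le {R Q : ℕ} (hQ : 2 ≤ Q) (hQR : 2 * Q ≤ R) {A B c' : ℝ} (hA1 : 1 ≤ A)
    (hΓU : ∀ x, Q < x → x ≤ R → exitGamma R Q x ≤ A * Real.log R / Real.log x) (hB0 : 0 ≤ B)
    (hψ : ∀ n, 1 ≤ n → n ≤ R → Real.log n - c' ≤ ∑ k ∈ Icc 1 n, vonMangoldt k / k)
    (hΓL : ∀ x, Q < x → x ≤ R → B * Real.log R / Real.log x ≤ exitGamma R Q x) :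
    exitChiSq R Q ≤ (∑ b ∈ Icc 1 Q, (1 : ℝ) / b) *
      max (A * Real.log R * (1 / Real.log ((Q : ℝ) + 1) - 1 / Real.log R +
              (39 / 50 + c' + 2 * Real.log 2) / Real.log ((Q : ℝ) + 1) ^ 2) - exitMassRatio R Q)
          (exitMassRatio R Q - B * Real.log R * (1 / Real.log (2 * (Q : ℝ)) - 1 / (Real.log R - Real.log 2) -
              (39 / 50 + c' + Real.log 2) / Real.log ((Q : ℝ) + 1) ^ 2)) ^ 2 := by
  set U := A * Real.log R * (1 / Real.log ((Q : ℝ) + 1) - 1 / Real.log R +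
              (39 / 50 + c' + 2 * Real.log 2) / Real.log ((Q : ℝ) + 1) ^ 2) with hU
  set Lo := B * Real.log R * (1 / Real.log (2 * (Q : ℝ)) - 1 / (Real.log R - Real.log 2) -
              (39 / 50 + c' + Real.log 2) / Real.log ((Q : ℝ) + 1) ^ 2) with hLo
  set c := exitMassRatio R Q with hc
  set E := max (U - c) (c - Lo) with hE
  unfold exitChiSq
  rw [Finset.sum_mul]
  refine Finset.sum_le_sum fun b hb => ?_
  have hb' := Finset.mem_Icc.1 hb
  have hb0 : (0:ℝ) < b := by exact_mod_cast (show 0 < b by omega)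
  have hup : (b : ℝ) * exitInflow R Q b ≤ U := mul_exitInflow_le hb'.1 hb'.2 hQR hA1 hΓU hψ
  have hlo : Lo ≤ (b : ℝ) * exitInflow R Q b := le_mul_exitInflow hb'.1 hb'.2 hQ hQR hB0 hψ hΓL
  -- |b ν(b) − c| ≤ E
  have habs : |(b : ℝ) * exitInflow R Q b - c| ≤ E := by
    rw [abs_le]
    constructor
    · have : c - Lo ≤ E := le_max_right _ _
      linarith
    · have : U - c ≤ E := le_max_left _ _
      linarith
  have hE0 : 0 ≤ E := le_trans (abs_nonneg _) habs
  -- b (ν − c/b)² = (1/b)(bν − c)²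
  have hrew : (b : ℝ) * (exitInflow R Q b - c / b) ^ 2 = (1 / (b:ℝ)) * ((b : ℝ) * exitInflow R Q b - c) ^ 2 := by
    field_simp
  rw [hrew]
  have hsq : ((b : ℝ) * exitInflow R Q b - c) ^ 2 ≤ E ^ 2 :=
    sq_le_sq' (by linarith [(abs_le.1 habs).1]) (abs_le.1 habs).2
  exact mul_le_mul_of_nonneg_left hsq (by positivity)

end Summit.RiemannHypothesis.RiemannHypothesis.Theorems.IntegerScrew

end
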